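import Literature.AnabelianGeometry.EtaleTheta.Discharge.Sec5Prop53ToyChainGeometry
import Literature.AnabelianGeometry.EtaleTheta.Discharge.Sec5Prop53PerfectVacuity
import Literature.AlgebraicGeometry.Frobenioids.PerfectionPrimes
import HarnessLib

/-!
# [EtTh] §5, Prop. 5.3 (iv): the p.326 CRITERIA binders (`hW`, `hCrit`) of the order-coordinate instance form
# `preservesCspToNcsp_of_orders` HOLD at a PERFECT toy `Φ(A_⊚)` — non-vacuity certificate for row F-0560

Mochizuki, *The étale theta function and its Frobenioid-theoretic manifestations*, Publ. RIMS **45** (2009), §5, Prop. 5.3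
(iv) p. 325 (PDF p. 99), proof p. 326 (PDF p. 100): "Suppose that `a ∈ Φ(A_⊚)^csp` is a primary cuspidal element; then there
exists a cuspidal element `b ∈ Φ(A_⊚)^csp` which is coprime to `a` such that `n := b − a` is cuspidally minimal [and] linearly
equivalent to a primary non-cuspidal element `n′`; the assignment `𝔞 ↦ 𝔫′` is the natural surjection of (iv)"
[cite: MochizukiEtTh2009, Prop 5.3 (iv) p.325 (PDF p.99); proof p.326 (PDF p.100)]; Prop. 5.1 p. 323 (PDF p. 97) (`Φ(−)` PERFECT).
Cell abc-iut, block F, seat abc-iut-f-127 (gen 2).  PROOF-ONLY certificate over `Sec5Prop53ToyChainGeometry.lean` (this seat: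
coefficient factorization `toyFactor`, degree-zero classes `toyPrincipal`, rigidity) on abc-iut-f-009's toy
(`Sec5Prop53Toy.lean`): no `def`, no instance, nothing landed is edited.

WHY.  The instance form `preservesCspToNcsp_of_orders` (this seat, `Sec5Prop53SurjectionOrders.lean`, p439550) replaced the
structure `DivisorSupportData'` — uninhabited at perfect `Φ(A_⊚)` — by binders; its two CRITERIA binders `hW`/`hCrit` (L6-d1's
`CspToNcspWitnessed'`/`CspToNcspCriterion'` read over `factor`/`P`) had no satisfiability certificate.  Here, at the toy datum
with `Φ(A_⊚) = ⊕_{ℤ ⊔ ℤ} ℚ_{≥0}` — PERFECT (`isPerfect_phiToy`), so that L6-d1's vocabulary of record is EMPTY there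
(`isEmpty_divisorSupportData'_toy`, from this seat's p434934) — they HOLD with `P :=` the degree-zero classes:
* `hW` (`cspToNcspWitnessed_toy`): at the cusp `j` take `a = 2·cusp_j`, `b = cusp_{j−1} + cusp_{j+1}`, `n = C_j`; then
  `b − a − C_j` has degree `0` on every component (`linEquiv_cuspB_div_cuspA_compN` — exactly the incidence numbers
  `C_j² = −2`, `C_j · C_{j±1} = 1`, `cusp_k · C_k = 1`; cf. F3 "the multiplicities of `n₁, n₂` are equal to … half the
  multiplicity of `a`"), and `b − a` is the UNIQUE cuspidal element of its class (rigidity), hence cuspidally minimal;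
* `hCrit` (`cspToNcspCriterion_toy`): if the situation occurs at the cusp `j` with a component `C_i`, the degree of
  `b′ − a′ − n′` on `C_j` is `−(mult a′) − (mult n′)·#{i = j ± 1} < 0` unless `i = j` — so the situation PINS `cusp_j ↦ C_j`;
* with `hψo`/`hP`/`hc` for the chain translations (ChainGeometry): **`preservesCspToNcsp_shift_viaOrders`** — (iv) at the toy
  derived THROUGH the order form with every binder discharged, and the ∃-form `surjection_binders_toy`.
Necessity of an intersection-theoretic `P`: for `P = ⊥` (`LinEquivOf = Eq`) `hW` fails (`b − a` is cuspidal, `n` is not),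
for `P = ⊤` cuspidal minimality forces empty support; the degree-zero `P` is what the printed proof uses (§1 p.240).

HONEST FRAMING: a toy certificate about OUR binders; nothing about [EtTh] §5's tempered Frobenioid or [IUTchIII] Cor. 3.12;
no side taken; typed ≠ proved.
-/

namespace Literature.AnabelianGeometry.EtaleTheta

namespace FrobenioidThetaDivisors

namespace Prop53Toy

open CategoryTheory
open Literature.AlgebraicGeometry.Frobenioids
open ConstantMultiple ConstantMultiple.Cor512Toy

/-! ### The p.326 situation at every cusp: `a = 2·cusp_j`, `b = cusp_{j−1} + cusp_{j+1}`, `n = C_j` -/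

/-- `[b] = cusp_{j−1} + cusp_{j+1}` is cuspidal. [cite: MochizukiEtTh2009, Prop 5.3 proof p.326 (PDF p.100)] -/
theorem isCuspidalGp_cuspB (j : ℤ) :
    IsCuspidalGpOf' toyPrimeData toyFactor (Algebra.GrothendieckGroup.of (cusp (j - 1) 1 * cusp (j + 1) 1)) := by
  rw [isCuspidalGpOf'_iff]
  intro n
  simp only [map_mul, cf_mul, cf_cusp, reduceCtorEq, if_false, add_zero]

/-- `[b] − [a]` is cuspidal. [cite: MochizukiEtTh2009, Prop 5.3 proof p.326 (PDF p.100)] -/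
theorem isCuspidalGp_cuspB_div_cuspA (j : ℤ) :
    IsCuspidalGpOf' toyPrimeData toyFactor
      (Algebra.GrothendieckGroup.of (cusp (j - 1) 1 * cusp (j + 1) 1) * (Algebra.GrothendieckGroup.of (cusp j 2))⁻¹) := by
  rw [isCuspidalGpOf'_iff]
  intro n
  simp only [map_mul, cf_mul, cf_inv, cf_cusp, reduceCtorEq, if_false, add_zero, neg_zero]

/-- `a` and `b` are coprime (disjoint supports `{cusp_j}`, `{cusp_{j−1}, cusp_{j+1}}`).
[cite: MochizukiEtTh2009, Prop 5.3 proof p.326 (PDF p.100)] -/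
theorem coprime_cuspA_cuspB (j : ℤ) :
    CoprimeOf' toyFactor (Algebra.GrothendieckGroup.of (cusp j 2))
      (Algebra.GrothendieckGroup.of (cusp (j - 1) 1 * cusp (j + 1) 1)) := by
  change Disjoint (suppOf' toyFactor _) (suppOf' toyFactor _)
  refine Set.disjoint_left.mpr fun 𝔭 h₁ h₂ => ?_
  rw [mem_suppOf'_iff, cf_cusp] at h₁
  rw [mem_suppOf'_iff, map_mul, cf_mul, cf_cusp, cf_cusp] at h₂
  by_cases h : idx 𝔭 = Sum.inr j
  · rw [h] at h₂
    simp only [Sum.inr.injEq] at h₂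
    rw [if_neg (by omega), if_neg (by omega)] at h₂
    exact h₂ (by norm_num)
  · rw [if_neg h] at h₁
    exact h₁ rfl

/-- **`b − a ~ n`**: `cusp_{j−1} + cusp_{j+1} − 2·cusp_j − C_j` has degree `0` on every component (the incidence
numbers of the chain: `C_j² = −2`, `C_j · C_{j±1} = 1`, `cusp_k · C_k = 1`).
[cite: MochizukiEtTh2009, §1 p.240 (PDF p.14); Prop 5.3 proof p.326 (PDF p.100)] -/
theorem linEquiv_cuspB_div_cuspA_compN (j : ℤ) :
    LinEquivOf toyPrincipal
      (Algebra.GrothendieckGroup.of (cusp (j - 1) 1 * cusp (j + 1) 1) * (Algebra.GrothendieckGroup.of (cusp j 2))⁻¹)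
      (Algebra.GrothendieckGroup.of (comp j 1)) := by
  rw [linEquivOf_toyPrincipal_iff]
  intro k
  simp only [map_mul, cf_mul, cf_inv, cf_cusp, cf_comp, Sum.inl.injEq, Sum.inr.injEq, reduceCtorEq, if_false]
  split_ifs <;> (try norm_num) <;> (exfalso; omega)

/-- The support of `[b] − [a]` lies in `{cusp_{j−1}, cusp_j, cusp_{j+1}}`; in particular it is finite.
[cite: MochizukiEtTh2009, Prop 5.3 proof p.326 (PDF p.100)] -/
theorem finite_supp_cuspB_div_cuspA (j : ℤ) :
    (suppOf' toyFactor
      (Algebra.GrothendieckGroup.of (cusp (j - 1) 1 * cusp (j + 1) 1) *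
        (Algebra.GrothendieckGroup.of (cusp j 2))⁻¹)).Finite := by
  refine ((((Set.finite_singleton (j + 1)).insert j).insert (j - 1)).image fun k : ℤ => Pt (Sum.inr k)).subset
    fun 𝔭 h𝔭 => ?_
  rw [mem_suppOf'_iff, map_mul, cf_mul, cf_mul, cf_inv, cf_cusp, cf_cusp, cf_cusp] at h𝔭
  rcases hi : idx 𝔭 with n | n
  · rw [hi] at h𝔭; simp at h𝔭
  · refine ⟨n, ?_, by change Pt (Sum.inr n) = 𝔭; rw [← hi, Pt_idx]⟩
    rw [hi] at h𝔭
    simp only [Sum.inr.injEq, Set.mem_insert_iff, Set.mem_singleton_iff] at h𝔭 ⊢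
    by_contra hn
    simp only [not_or] at hn
    obtain ⟨h1, h2, h3⟩ := hn
    rw [if_neg h1, if_neg h3, if_neg h2] at h𝔭
    exact h𝔭 (by norm_num)

/-- **`b − a` is cuspidally minimal**: it is the ONLY cuspidal element of its linear equivalence class (rigidity),
so its (finite) support has minimal cardinality. [cite: MochizukiEtTh2009, Prop 5.3 proof p.326 (PDF p.100)] -/
theorem isCuspidallyMinimal_cuspB_div_cuspA (j : ℤ) :
    IsCuspidallyMinimalOf' toyPrimeData toyFactor toyPrincipal
      (Algebra.GrothendieckGroup.of (cusp (j - 1) 1 * cusp (j + 1) 1) *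
        (Algebra.GrothendieckGroup.of (cusp j 2))⁻¹) := by
  refine ⟨isCuspidalGp_cuspB_div_cuspA j, finite_supp_cuspB_div_cuspA j, fun y hy _ hyx => ?_⟩
  rw [eq_of_isCuspidalGp_of_linEquiv hy (isCuspidalGp_cuspB_div_cuspA j) hyx]

/-! ### `hW` and `hCrit` at the toy -/

/-- **The binder `hW` of `preservesCspToNcsp_of_orders` HOLDS at the toy** (with `factor := toyFactor`,
`P := toyPrincipal`): at every cusp `j` the p.326 situation occurs, witnessed by `a = 2·cusp_j`,
`b = cusp_{j−1} + cusp_{j+1}`, `n = C_j`. [cite: MochizukiEtTh2009, Prop 5.3 proof p.326 (PDF p.100)] -/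
theorem cspToNcspWitnessed_toy :
    ∀ 𝔞 : Primes PhiToy, toyPrimeData.IsCuspidal 𝔞 →
      ∃ (𝔫 : Primes PhiToy) (_ : ¬ toyPrimeData.IsCuspidal 𝔫) (a b n : PhiToy),
        a ∈ 𝔞.carrier ∧ n ∈ 𝔫.carrier ∧
        IsCuspidalGpOf' toyPrimeData toyFactor (Algebra.GrothendieckGroup.of b) ∧
        CoprimeOf' toyFactor (Algebra.GrothendieckGroup.of a) (Algebra.GrothendieckGroup.of b) ∧
        IsCuspidallyMinimalOf' toyPrimeData toyFactor toyPrincipal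
          (Algebra.GrothendieckGroup.of b * (Algebra.GrothendieckGroup.of a)⁻¹) ∧
        LinEquivOf toyPrincipal (Algebra.GrothendieckGroup.of b * (Algebra.GrothendieckGroup.of a)⁻¹)
          (Algebra.GrothendieckGroup.of n) := by
  rintro 𝔞 ⟨j, hj⟩
  have h𝔞 : 𝔞 = Pt (Sum.inr j) := by rw [← Pt_idx 𝔞]; exact congrArg Pt hj
  subst h𝔞
  exact ⟨Pt (Sum.inl j), not_isCusp_P_inl j, cusp j 2, cusp (j - 1) 1 * cusp (j + 1) 1, comp j 1,
    cusp_mem_carrier j two_ne_zero, comp_mem_carrier j one_ne_zero, isCuspidalGp_cuspB j, coprime_cuspA_cuspB j,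
    isCuspidallyMinimal_cuspB_div_cuspA j, linEquiv_cuspB_div_cuspA_compN j⟩

/-- **The binder `hCrit` of `preservesCspToNcsp_of_orders` HOLDS at the toy**: whenever the p.326 situation occurs
at a cusp `𝔞` with a component `𝔫`, then `𝔫` is the component carrying `𝔞` — the degree of `b − a − n` on the
component of `𝔞` would be `−(mult. of a) − (mult. of n)·#{𝔫 adjacent to it} < 0` otherwise.
[cite: MochizukiEtTh2009, §1 p.240 (PDF p.14); Prop 5.3 proof p.326 (PDF p.100)] -/
theorem cspToNcspCriterion_toy :
    ∀ (𝔞 𝔫 : Primes PhiToy) (h𝔞 : toyPrimeData.IsCuspidal 𝔞) (h𝔫 : ¬ toyPrimeData.IsCuspidal 𝔫)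
      (a b n : PhiToy), a ∈ 𝔞.carrier → n ∈ 𝔫.carrier →
      IsCuspidalGpOf' toyPrimeData toyFactor (Algebra.GrothendieckGroup.of b) →
      CoprimeOf' toyFactor (Algebra.GrothendieckGroup.of a) (Algebra.GrothendieckGroup.of b) →
      IsCuspidallyMinimalOf' toyPrimeData toyFactor toyPrincipal
        (Algebra.GrothendieckGroup.of b * (Algebra.GrothendieckGroup.of a)⁻¹) →
      LinEquivOf toyPrincipal (Algebra.GrothendieckGroup.of b * (Algebra.GrothendieckGroup.of a)⁻¹)
        (Algebra.GrothendieckGroup.of n) →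
      toyPrimeData.cspToNcsp ⟨𝔞, h𝔞⟩ = ⟨𝔫, h𝔫⟩ := by
  rintro 𝔞 𝔫 ⟨j, hj⟩ h𝔫 a b n ha hn hb hab - hlin
  obtain ⟨i, hi⟩ := idx_eq_inl_of_not_isCusp h𝔫
  have h𝔞P : 𝔞 = Pt (Sum.inr j) := by rw [← Pt_idx 𝔞]; exact congrArg Pt hj
  have h𝔫P : 𝔫 = Pt (Sum.inl i) := by rw [← Pt_idx 𝔫]; exact congrArg Pt hi
  apply Subtype.ext
  change Pt (Sum.inl (label 𝔞)) = 𝔫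
  have hl : label 𝔞 = j := by simp [label, hj]
  rw [hl, h𝔫P]
  subst h𝔞P h𝔫P
  -- the coefficients of `a`, `b`, `n` entering `deg_j (b − a − n)`
  have hα := cf_pos_of_mem_carrier ha
  have hβ := cf_pos_of_mem_carrier hn
  have hb' := (isCuspidalGpOf'_iff _).mp hb
  have hbj : cf (Sum.inr j) (Algebra.GrothendieckGroup.of b) = 0 := by
    by_contra hne
    exact Set.disjoint_left.mp hab ((Pt_mem_suppOf'_iff _ _).mpr hα.ne') ((Pt_mem_suppOf'_iff _ _).mpr hne)
  have hdeg := ((linEquivOf_toyPrincipal_iff _ _).mp hlin) j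
  simp only [cf_mul, cf_inv] at hdeg
  rw [cf_of_mem_carrier ha (Sum.inl (j - 1)), cf_of_mem_carrier ha (Sum.inl j), cf_of_mem_carrier ha (Sum.inl (j + 1)),
    cf_of_mem_carrier hn (Sum.inl (j - 1)), cf_of_mem_carrier hn (Sum.inl j), cf_of_mem_carrier hn (Sum.inl (j + 1)),
    cf_of_mem_carrier hn (Sum.inr j), hb', hb', hb', hbj] at hdeg
  simp only [Sum.inl.injEq, reduceCtorEq, if_false] at hdeg
  by_contra hij
  have hij' : ¬ j = i := fun h => hij (by rw [h])
  rw [if_neg hij'] at hdeg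
  set α := cf (Sum.inr j) (Algebra.GrothendieckGroup.of a)
  set β := cf (Sum.inl i) (Algebra.GrothendieckGroup.of n)
  have e1 : (0 : ℚ) ≤ (if j - 1 = i then β else 0) := by split_ifs <;> [exact hβ.le; exact le_rfl]
  have e2 : (0 : ℚ) ≤ (if j + 1 = i then β else 0) := by split_ifs <;> [exact hβ.le; exact le_rfl]
  linarith


/-! ### The toy `Φ(A_⊚)` is PERFECT: the forms of record are vacuous here, the order forms are not -/

/-- `Φ(A_⊚) = ⊕_{ℤ ⊔ ℤ} ℚ_{≥0}` of the toy datum is PERFECT ([FrdI] §0: every `n`-th power map bijective) — as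
[EtTh] Prop. 5.1 asserts for the genuine `Φ(−)`. [cite: MochizukiEtTh2009, Prop 5.1 p.323 (PDF p.97)] -/
theorem isPerfect_phiToy : IsPerfect PhiToy := by
  change IsPerfect Φt
  refine ⟨fun n hn => ⟨fun f g hfg => ?_, fun g => ?_⟩⟩
  · refine Subtype.ext (funext fun i => (isPerfect_multiplicative_nnrat.bijective_pow n hn).1 ?_)
    have := congrArg (fun h : Φt => (h : ∀ i, Fac i) i) hfg
    simpa [DirectSum.coe_pow] using this
  · choose r hr using fun i => (isPerfect_multiplicative_nnrat.bijective_pow n hn).2 ((g : ∀ i, Fac i) i)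
    have hsupp : dsupp (fun i => r i) ⊆ dsupp (g : ∀ i, Fac i) := by
      intro i hi hgi
      apply hi
      apply (isPerfect_multiplicative_nnrat.bijective_pow n hn).1
      change r i ^ n = (1 : Fac i) ^ n
      rw [one_pow]
      exact (hr i).trans hgi
    refine ⟨⟨fun i => r i, (DirectSum.finite_dsupp g).subset hsupp⟩, Subtype.ext (funext fun i => ?_)⟩
    change ((⟨fun i => r i, _⟩ : Φt) ^ n : Φt).1 i = (g : ∀ i, Fac i) i
    rw [DirectSum.coe_pow, Pi.pow_apply]
    exact hr i

/-- Hence, at this datum, abc-iut-L6-d1's support vocabulary of record is UNINHABITED (this seat's p434934): the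
instance forms `preservesCspToNcsp_of_criterion'` / `preservesNcspLabels_of_supportData'` say nothing here.
[cite: MochizukiEtTh2009, Prop 5.1 p.323 (PDF p.97); Prop 5.3 p.325 (PDF p.99)] -/
theorem isEmpty_divisorSupportData'_toy : IsEmpty (DivisorSupportData' toyPrimeData) :=
  isEmpty_divisorSupportData'_of_isPerfect toyPrimeData isPerfect_phiToy

/-! ### The certificate for (iv) -/

/-- **NON-VACUITY of the binders of `preservesCspToNcsp_of_orders` (row F-0560)** at the perfect toy `Φ(A_⊚)`, for every
chain translation `e = reindex (shift t)`: `factor := toyFactor`, `P := toyPrincipal` satisfy `hψo`, `hP`, `hW`, `hCrit`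
simultaneously (with `hc := cuspPreserved_shift t`). [cite: MochizukiEtTh2009, Prop 5.3 proof p.326 (PDF p.100)] -/
theorem surjection_binders_toy (t : ℤ) :
    ∃ (factor : PhiToy →* (Primes PhiToy → Multiplicative ℚ)) (P : Subgroup GpToy),
      (∀ (𝔭 : Primes PhiToy) (a : PhiToy),
        ordOf' factor (Primes.congr (psiToy (shift t)) 𝔭) (psiToy (shift t) a) = ordOf' factor 𝔭 a) ∧
      (∀ x, ThetaFrobenioid.gpMap (psiToy (shift t)).toMonoidHom x ∈ P ↔ x ∈ P) ∧
      (∀ 𝔞 : Primes PhiToy, toyPrimeData.IsCuspidal 𝔞 →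
        ∃ (𝔫 : Primes PhiToy) (_ : ¬ toyPrimeData.IsCuspidal 𝔫) (a b n : PhiToy),
          a ∈ 𝔞.carrier ∧ n ∈ 𝔫.carrier ∧
          IsCuspidalGpOf' toyPrimeData factor (Algebra.GrothendieckGroup.of b) ∧
          CoprimeOf' factor (Algebra.GrothendieckGroup.of a) (Algebra.GrothendieckGroup.of b) ∧
          IsCuspidallyMinimalOf' toyPrimeData factor P
            (Algebra.GrothendieckGroup.of b * (Algebra.GrothendieckGroup.of a)⁻¹) ∧
          LinEquivOf P (Algebra.GrothendieckGroup.of b * (Algebra.GrothendieckGroup.of a)⁻¹)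
            (Algebra.GrothendieckGroup.of n)) ∧
      (∀ (𝔞 𝔫 : Primes PhiToy) (h𝔞 : toyPrimeData.IsCuspidal 𝔞) (h𝔫 : ¬ toyPrimeData.IsCuspidal 𝔫)
        (a b n : PhiToy), a ∈ 𝔞.carrier → n ∈ 𝔫.carrier →
        IsCuspidalGpOf' toyPrimeData factor (Algebra.GrothendieckGroup.of b) →
        CoprimeOf' factor (Algebra.GrothendieckGroup.of a) (Algebra.GrothendieckGroup.of b) →
        IsCuspidallyMinimalOf' toyPrimeData factor P
          (Algebra.GrothendieckGroup.of b * (Algebra.GrothendieckGroup.of a)⁻¹) →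
        LinEquivOf P (Algebra.GrothendieckGroup.of b * (Algebra.GrothendieckGroup.of a)⁻¹)
          (Algebra.GrothendieckGroup.of n) →
        toyPrimeData.cspToNcsp ⟨𝔞, h𝔞⟩ = ⟨𝔫, h𝔫⟩) :=
  ⟨toyFactor, toyPrincipal, ordMap_toy (shift t), gpMap_psiToy_shift_mem_toyPrincipal_iff t, cspToNcspWitnessed_toy,
    cspToNcspCriterion_toy⟩

/-- **[EtTh] Prop. 5.3 (iv) AT THE TOY, derived THROUGH the order-coordinate instance form** `preservesCspToNcsp_of_orders`
(row F-0560; this seat, p439550) with every binder discharged — the form is not vacuous.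
[cite: MochizukiEtTh2009, Prop 5.3 (iv) p.325 (PDF p.99); proof p.326 (PDF p.100)] -/
theorem preservesCspToNcsp_shift_viaOrders (t : ℤ) :
    PreservesCspToNcsp toyPrimeData (CategoryTheory.Equivalence.refl : TC ≌ TC) (Iso.refl Q) (reindex (shift t))
      (cuspPreserved_shift t) :=
  preservesCspToNcsp_of_orders toyPrimeData _ _ _ toyFactor toyPrincipal (cuspPreserved_shift t) (ordMap_toy (shift t))
    (gpMap_psiToy_shift_mem_toyPrincipal_iff t) cspToNcspWitnessed_toy cspToNcspCriterion_toy

end Prop53Toy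

end FrobenioidThetaDivisors

end Literature.AnabelianGeometry.EtaleTheta
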